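import Literature.Computability.FineGrained.SerfKSatFST
import Literature.Computability.Complexity.SymbolPrograms
import HarnessLib

/-!
# SERF reduction of `k`-SAT (parameter `n`) to `k`-SAT (parameter `m`), III: the back end

Family `fine-grained`. Third file of the machine behind
`Literature.Computability.FineGrained.serfReducible_kSATParam_kSATClauseParam` (Impagliazzo–Paturi–Zane,
JCSS 63 (2001), §2, Cor. 1–2). After the sparsifier has run (inside the context machine
`TM2Ctx.ctxTM`), the tape holds the `Γ'`-codes of the sparse formulas `ψ₀, …, ψ_{r-1}`
(`KCNF.encodeList`, lifted to `Option Γ'`), the terminator `none`, the flag of the front end, one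
tick per oracle answer already received (`i` of them), a second `none`, and the answer bits. The
back end is a structured stack program over `Option Γ'` (`Complexity.ACom`, compiled to Mathlib's
`Turing.FinTM2` with exact step counts by `ACom.exists_computesInTime`) producing the step of the
oracle algorithm in the output format of `SERFReducible` (`sumBool`: `0 · code` for a query,
`1 · b` for the answer `b`), as bits `some (bit _)`:

* flag down (the instance was not a `k`-CNF code): the answer `false`;
* `i < r`: the query `encodingCNF.encode ψᵢ.clauses` — formula `i` is selected by consuming one
  tick per formula boundary and transliterated from `KCNF.encode` into the tree's Boolean CNF code
  (unary headers are produced by counting into accumulator registers: clause blocks in `cb`,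
  literal blocks in `lb`, the code in `outr`);
* `i ≥ r`: the answer "some oracle answer was `true`".

Main result: `SerfKSat.Post.runs_prog` (effect and linear cost of the program) and
`SerfKSat.Post.computesInTime` (the compiled machine).

## References

* R. Impagliazzo, R. Paturi, F. Zane, *Which problems have strongly exponential complexity?*,
  J. Comput. System Sci. 63 (2001) 512–530, §2, Cor. 1–2.
* T. Nipkow, G. Klein, *Concrete Semantics with Isabelle/HOL*, Springer 2014, Ch. 7 (big-step
  reasoning about structured programs).
-/

namespace Literature.Computability.FineGrained.SerfKSat

open _root_.Computability Complexity Complexity.ACom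
open Complexity.Com (repBits repBits_cons repBits_nil repBits_append repBits_repBits)

/-! ### The flat form of the Boolean CNF code -/

/-- The block of a literal `(v, b)` in a CNF code: the numeral repeated eightfold, `0⁴1⁴`, `b⁴`,
`0011`. [folklore] -/
def lblock (l : Literal ℕ) : List Bool :=
  repBits 8 (encodeNat l.1) ++ [false, false, false, false, true, true, true, true, l.2, l.2, l.2, l.2,
    false, false, true, true]

/-- The block of a clause in a CNF code: `1^{4k} 0011`, the literal blocks, `01`. [folklore] -/
def cblock (c : Clause ℕ) : List Bool :=
  List.replicate (4 * c.length) true ++ ([false, false, true, true] ++ (c.flatMap lblock ++ [false, true]))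

/-- **The flat form of `encodingCNF`**: `1^{2m} 01` and the clause blocks. [folklore] -/
theorem encodingCNF_encode_eq (cs : CNF ℕ) :
    encodingCNF.encode cs = List.replicate (2 * cs.length) true ++ ([false, true] ++ cs.flatMap cblock) := by
  have hlit : ∀ l : Literal ℕ, repBits 4 (encodingLiteral.encode l) ++ [false, false, true, true] = lblock l := by
    rintro ⟨v, b⟩
    rw [show encodingLiteral.encode (v, b) = boolPair (encodeNat v) [b] from rfl, boolPair_eq, repBits_append,
      repBits_append, repBits_repBits, lblock]
    simp [repBits, List.replicate]
  have hcl : ∀ c : Clause ℕ, repBits 2 (encodingClause.encode c) ++ [false, true] = cblock c := by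
    intro c
    rw [show encodingClause.encode c = encodingLiteral.listBool.encode c from rfl, listBool_encode_eq,
      OracleCompose.unaryEncodeNat_eq_replicate]
    have : ∀ c : Clause ℕ, repBits 2 (frames (c.map encodingLiteral.encode)) = c.flatMap lblock := by
      intro c
      induction c with
      | nil => simp
      | cons l c ih =>
        rw [List.map_cons, frames_cons, repBits_append, repBits_append, ih, List.flatMap_cons, repBits_repBits,
          ← hlit, List.append_assoc]
        simp [repBits, List.replicate]
    rw [repBits_append, repBits_append, this, repBits_repBits, repBits_replicate, cblock]
    simp
  rw [show encodingCNF.encode cs = encodingClause.listBool.encode cs from rfl, listBool_encode_eq,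
    OracleCompose.unaryEncodeNat_eq_replicate, repBits_replicate]
  have : ∀ cs : CNF ℕ, frames (cs.map encodingClause.encode) = cs.flatMap cblock := by
    intro cs
    induction cs with
    | nil => simp
    | cons c cs ih => rw [List.map_cons, frames_cons, ih, List.flatMap_cons, ← hcl, List.append_assoc]
  rw [this]
  simp

namespace Post

/-! ### Registers and stores -/

/-- The registers of the back end: input, output, the field reversed (`a`) and in order (`b`),
the flag (`fl`), the true answers (`ob`), the ticks (`tk`), the mode (`st`), the code being built
(`outr`), the clause blocks (`cb`) and literal blocks (`lb`) of the current formula / clause, and a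
transfer register (`t1`). [folklore] -/
inductive KP where
  | inp | out | a | b | fl | ob | tk | st | outr | cb | lb | t1
  deriving DecidableEq, Fintype

/-- Symbols. [folklore] -/
abbrev Sym : Type := Option Γ'

/-- Stores of the back end. [folklore] -/
abbrev Store : Type := AStore Sym KP

/-- Programs of the back end. [folklore] -/
abbrev Prog : Type := ACom Sym KP

/-- The contents of the registers, as a record. [folklore] -/
structure Regs where
  /-- input -/ inp : List Sym
  /-- output -/ out : List Sym
  /-- field, reversed -/ a : List Sym
  /-- field, in order -/ b : List Sym
  /-- flag (nonempty = the instance was bad) -/ fl : List Sym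
  /-- one mark per true answer -/ ob : List Sym
  /-- one mark per unused tick -/ tk : List Sym
  /-- the mode symbol -/ st : List Sym
  /-- the code being built, reversed -/ outr : List Sym
  /-- clause blocks, reversed -/ cb : List Sym
  /-- literal blocks, reversed -/ lb : List Sym
  /-- transfer -/ t1 : List Sym

/-- The store of a record. [folklore] -/
def mk (F : Regs) : Store
  | .inp => F.inp | .out => F.out | .a => F.a | .b => F.b | .fl => F.fl | .ob => F.ob | .tk => F.tk
  | .st => F.st | .outr => F.outr | .cb => F.cb | .lb => F.lb | .t1 => F.t1

/-- Updating one register of a record. [folklore] -/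
def setR (F : Regs) : KP → List Sym → Regs
  | .inp, v => { F with inp := v } | .out, v => { F with out := v } | .a, v => { F with a := v }
  | .b, v => { F with b := v } | .fl, v => { F with fl := v } | .ob, v => { F with ob := v }
  | .tk, v => { F with tk := v } | .st, v => { F with st := v } | .outr, v => { F with outr := v }
  | .cb, v => { F with cb := v } | .lb, v => { F with lb := v } | .t1, v => { F with t1 := v }

/-- Projection of a record store. [folklore] -/
@[simp] theorem mk_inp (F : Regs) : mk F .inp = F.inp := rfl
/-- Projection of a record store. [folklore] -/
@[simp] theorem mk_out (F : Regs) : mk F .out = F.out := rfl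
/-- Projection of a record store. [folklore] -/
@[simp] theorem mk_a (F : Regs) : mk F .a = F.a := rfl
/-- Projection of a record store. [folklore] -/
@[simp] theorem mk_b (F : Regs) : mk F .b = F.b := rfl
/-- Projection of a record store. [folklore] -/
@[simp] theorem mk_fl (F : Regs) : mk F .fl = F.fl := rfl
/-- Projection of a record store. [folklore] -/
@[simp] theorem mk_ob (F : Regs) : mk F .ob = F.ob := rfl
/-- Projection of a record store. [folklore] -/
@[simp] theorem mk_tk (F : Regs) : mk F .tk = F.tk := rfl
/-- Projection of a record store. [folklore] -/
@[simp] theorem mk_st (F : Regs) : mk F .st = F.st := rfl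
/-- Projection of a record store. [folklore] -/
@[simp] theorem mk_outr (F : Regs) : mk F .outr = F.outr := rfl
/-- Projection of a record store. [folklore] -/
@[simp] theorem mk_cb (F : Regs) : mk F .cb = F.cb := rfl
/-- Projection of a record store. [folklore] -/
@[simp] theorem mk_lb (F : Regs) : mk F .lb = F.lb := rfl
/-- Projection of a record store. [folklore] -/
@[simp] theorem mk_t1 (F : Regs) : mk F .t1 = F.t1 := rfl

/-- Updating the store of a record updates the record. [folklore] -/
@[simp] theorem update_mk (F : Regs) (k : KP) (v : List Sym) : Function.update (mk F) k v = mk (setR F k v) := by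
  funext r; cases r <;> cases k <;> rfl

/-- Updating one register of a record. [folklore] -/
@[simp] theorem setR_inp (F : Regs) (v : List Sym) : setR F .inp v = { F with inp := v } := rfl
/-- Updating one register of a record. [folklore] -/
@[simp] theorem setR_out (F : Regs) (v : List Sym) : setR F .out v = { F with out := v } := rfl
/-- Updating one register of a record. [folklore] -/
@[simp] theorem setR_a (F : Regs) (v : List Sym) : setR F .a v = { F with a := v } := rfl
/-- Updating one register of a record. [folklore] -/
@[simp] theorem setR_b (F : Regs) (v : List Sym) : setR F .b v = { F with b := v } := rfl
/-- Updating one register of a record. [folklore] -/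
@[simp] theorem setR_fl (F : Regs) (v : List Sym) : setR F .fl v = { F with fl := v } := rfl
/-- Updating one register of a record. [folklore] -/
@[simp] theorem setR_ob (F : Regs) (v : List Sym) : setR F .ob v = { F with ob := v } := rfl
/-- Updating one register of a record. [folklore] -/
@[simp] theorem setR_tk (F : Regs) (v : List Sym) : setR F .tk v = { F with tk := v } := rfl
/-- Updating one register of a record. [folklore] -/
@[simp] theorem setR_st (F : Regs) (v : List Sym) : setR F .st v = { F with st := v } := rfl
/-- Updating one register of a record. [folklore] -/
@[simp] theorem setR_outr (F : Regs) (v : List Sym) : setR F .outr v = { F with outr := v } := rfl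
/-- Updating one register of a record. [folklore] -/
@[simp] theorem setR_cb (F : Regs) (v : List Sym) : setR F .cb v = { F with cb := v } := rfl
/-- Updating one register of a record. [folklore] -/
@[simp] theorem setR_lb (F : Regs) (v : List Sym) : setR F .lb v = { F with lb := v } := rfl
/-- Updating one register of a record. [folklore] -/
@[simp] theorem setR_t1 (F : Regs) (v : List Sym) : setR F .t1 v = { F with t1 := v } := rfl

/-- The single-register stores are records. [folklore] -/
theorem single_inp (w : List Sym) : AStore.single KP.inp w = mk ⟨w, [], [], [], [], [], [], [], [], [], [], []⟩ := by
  funext r; cases r <;> rfl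

/-- The single-register stores are records. [folklore] -/
theorem single_out (w : List Sym) : AStore.single KP.out w = mk ⟨[], w, [], [], [], [], [], [], [], [], [], []⟩ := by
  funext r; cases r <;> rfl

/-! ### Symbols -/

/-- The mark used on the flag, tick and answer registers. [folklore] -/
def mark : Sym := none
/-- A bit of the output. [folklore] -/
def bt (b : Bool) : Sym := some (Γ'.bit b)
/-- Mode: skipping a formula. [folklore] -/
def SKP : Sym := some Γ'.bra
/-- Mode: in the header of the selected formula. [folklore] -/
def HD : Sym := some Γ'.ket
/-- Mode: between clauses of the selected formula. [folklore] -/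
def CL : Sym := some Γ'.comma
/-- Mode: in a clause, at a literal start. [folklore] -/
def LT : Sym := some Γ'.blank
/-- Mode: in the digits of a literal of polarity `b`. [folklore] -/
def DG (b : Bool) : Sym := some (Γ'.bit b)
/-- Mode: past the selected formula. [folklore] -/
def DONE : Sym := none

/-! ### The program -/

/-- Phase 1, answers: one mark on `ob` per true answer bit. [folklore] -/
def ansBody : Sym → Prog
  | some (Γ'.bit true) => push .ob mark
  | _ => skip

/-- Phase 1, answers loop. [folklore] -/
def pAns : Prog := loop .inp ansBody

/-- Phase 1, ticks: one mark on `tk` per tick, then (at the second `none`) the answers. [folklore] -/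
def tickBody : Sym → Prog
  | some _ => push .tk mark
  | none => pAns

/-- Phase 1, ticks loop. [folklore] -/
def pTicks : Prog := loop .inp tickBody

/-- Reading the flag symbol: a mark on `fl` iff the flag is down. [folklore] -/
def readFlag : Prog := pop .inp fun f => match f with
  | some (some (Γ'.bit false)) => push .fl mark
  | _ => skip

/-- Phase 1: the field onto `a` (reversed), then (at the first `none`) the flag, the ticks and the
answers. [folklore] -/
def p1Body : Sym → Prog
  | some γ => push .a (some γ)
  | none => readFlag ;; pTicks

/-- Phase 1 loop. [folklore] -/
def p1 : Prog := loop .inp p1Body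

/-- Deciding the mode at a formula boundary: skip the next formula if a tick is left, otherwise
select it (mode `HD`, and the tag bit `0` of a query is emitted). [folklore] -/
def boundary : Prog := pop .tk fun o => match o with
  | some _ => push .st SKP
  | none => push .st HD ;; push .outr (bt false)

/-- Push the bits of `w` in order onto `k` (as output bits). [folklore] -/
def pushBits (k : KP) (w : List Bool) : Prog := pushList k (w.map bt)

/-- The action of the main loop on symbol `s` in the mode `m` popped from `st` (each branch pushes
the next mode). [folklore] -/
def dispatch : Option Sym → Sym → Prog
  | some (some Γ'.bra), s => (match s with            -- SKP
      | some Γ'.blank => boundary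
      | _ => push .st SKP)
  | some (some Γ'.ket), s => (match s with            -- HD
      | some Γ'.comma => push .st CL
      | _ => push .st HD)
  | some (some Γ'.comma), s => (match s with          -- CL
      | some Γ'.bra => pushBits .outr [true, true] ;; push .st LT
      | some Γ'.blank => pushBits .outr [false, true] ;; pour .cb .t1 ;; pour .t1 .outr ;; push .st DONE
      | _ => push .st CL)
  | some (some Γ'.blank), s => (match s with          -- LT
      | some (Γ'.bit b) => pushBits .cb [true, true, true, true] ;; push .st (DG b)
      | some Γ'.ket => pushBits .cb [false, false, true, true] ;; pour .lb .t1 ;; pour .t1 .cb ;;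
          pushBits .cb [false, true] ;; push .st CL
      | _ => push .st LT)
  | some (some (Γ'.bit b)), s => (match s with        -- DG b
      | some (Γ'.bit d) => pushBits .lb [d, d, d, d, d, d, d, d] ;; push .st (DG b)
      | some Γ'.comma => pushBits .lb [false, false, false, false, true, true, true, true, b, b, b, b,
          false, false, true, true] ;; push .st LT
      | _ => push .st (DG b))
  | some none, _ => push .st DONE                     -- DONE
  | none, _ => skip

/-- The body of the main loop: pop the mode and dispatch. [folklore] -/
def body3 (s : Sym) : Prog := pop .st fun m => dispatch m s

/-- Phase 3: the main loop over the field. [folklore] -/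
def p3 : Prog := loop .b body3

/-- Phase 4: the output. [folklore] -/
def p4 : Prog := pop .fl fun f => match f with
  | some _ => clear .st ;; clear .tk ;; clear .ob ;; clear .outr ;; clear .cb ;; clear .lb ;;
      push .out (bt false) ;; push .out (bt true)
  | none => pop .st fun m => match m with
    | some none => pour .outr .out ;; clear .tk ;; clear .ob
    | _ => clear .tk ;; clear .outr ;; pop .ob fun o => match o with
      | some _ => clear .ob ;; push .out (bt true) ;; push .out (bt true)
      | none => push .out (bt false) ;; push .out (bt true)

/-- **The back end.** [folklore] -/
def prog : Prog := (p1 ;; (pour .a .b ;; (boundary ;; p3))) ;; p4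

/-! ### Phase 1 -/

/-- `pushBits` pushes the bits in order. [folklore] -/
theorem runs_pushBits (k : KP) (w : List Bool) (F : Regs) :
    Runs (pushBits k w) (mk F) (mk (setR F k ((w.map bt).reverse ++ mk F k))) w.length := by
  simpa [pushBits] using runs_pushList k (w.map bt) (mk F)

/-- The answers loop: one mark per true answer bit. [folklore] -/
theorem runs_pAns (bs : List Bool) : ∀ F : Regs,
    Runs pAns (mk { F with inp := bs.map bt }) (mk { F with inp := [], ob := List.replicate (bs.count true) mark ++ F.ob })
      (3 * bs.length + 1) := by
  induction bs with
  | nil => intro F; exact (Runs.loop_nil ansBody (by simp)).of_eq (by simp) (by simp)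
  | cons b bs ih =>
    intro F
    cases b
    · have h1 : Runs (ansBody (bt false)) (Function.update (mk { F with inp := (false :: bs).map bt }) .inp (bs.map bt))
          (mk { F with inp := bs.map bt }) 0 := (Runs.skip _).of_eq (by simp) le_rfl
      exact (Runs.loop_cons (f := ansBody) (by simp) h1 (ih F)).of_eq (by simp) (by simp; omega)
    · have h1 : Runs (ansBody (bt true)) (Function.update (mk { F with inp := (true :: bs).map bt }) .inp (bs.map bt))
          (mk { F with inp := bs.map bt, ob := mark :: F.ob }) 1 := Runs.push' (by simp)
      have h2 := ih { F with ob := mark :: F.ob }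
      simp only at h2
      refine (Runs.loop_cons (f := ansBody) (by simp) h1 h2).of_eq ?_ (by simp; omega)
      simp [List.replicate_succ']

/-- The ticks loop: one mark per tick, then the answers. [folklore] -/
theorem runs_pTicks (i : ℕ) (bs : List Bool) : ∀ F : Regs,
    Runs pTicks (mk { F with inp := List.replicate i (bt true) ++ mark :: bs.map bt })
      (mk { F with inp := [], tk := List.replicate i mark ++ F.tk, ob := List.replicate (bs.count true) mark ++ F.ob })
      (3 * i + 3 * bs.length + 4) := by
  induction i with
  | zero =>
    intro F
    have h1 : Runs (tickBody mark) (Function.update (mk { F with inp := mark :: bs.map bt }) .inp (bs.map bt))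
        (mk { F with inp := [], ob := List.replicate (bs.count true) mark ++ F.ob }) (3 * bs.length + 1) := by
      change Runs pAns _ _ _
      simpa using runs_pAns bs F
    have h2 : Runs pTicks (mk { F with inp := [], ob := List.replicate (bs.count true) mark ++ F.ob })
        (mk { F with inp := [], ob := List.replicate (bs.count true) mark ++ F.ob }) 1 := Runs.loop_nil _ (by simp)
    exact (Runs.loop_cons (f := tickBody) (by simp) h1 h2).of_eq (by simp) (by omega)
  | succ i ih =>
    intro F
    have h1 : Runs (tickBody (bt true))
        (Function.update (mk { F with inp := List.replicate (i + 1) (bt true) ++ mark :: bs.map bt }) .inp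
          (List.replicate i (bt true) ++ mark :: bs.map bt))
        (mk { F with inp := List.replicate i (bt true) ++ mark :: bs.map bt, tk := mark :: F.tk }) 1 := Runs.push' (by simp)
    have h2 := ih { F with tk := mark :: F.tk }
    simp only at h2
    exact (Runs.loop_cons (f := tickBody) (by simp [List.replicate_succ]) h1 h2).of_eq
      (by simp [List.replicate_succ']) (by omega)

/-- The word handed to the back end: the field, `none`, the flag, the ticks, `none`, the answer
bits. [folklore] -/
def postIn {k : ℕ} (Fs : List (KCNF k)) (g : Bool) (i : ℕ) (bs : List Bool) : List Sym :=
  (KCNF.encodeList Fs).map some ++ none :: bt g :: (List.replicate i (bt true) ++ none :: bs.map bt)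

/-- The flag register: a mark iff the flag is down. [folklore] -/
def flagR (g : Bool) : List Sym := if g then [] else [mark]

/-- Reading the flag. [folklore] -/
theorem runs_readFlag (g : Bool) (rest : List Sym) (F : Regs) :
    Runs readFlag (mk { F with inp := bt g :: rest }) (mk { F with inp := rest, fl := flagR g ++ F.fl }) 3 := by
  unfold readFlag
  cases g with
  | false =>
    have h : Runs (push KP.fl mark : Prog) (Function.update (mk { F with inp := bt false :: rest }) .inp rest)
        (mk { F with inp := rest, fl := flagR false ++ F.fl }) 1 := Runs.push' (by simp [flagR])
    exact Runs.mono (Runs.pop_cons rfl h) (by norm_num)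
  | true =>
    have h : Runs (skip : Prog) (Function.update (mk { F with inp := bt true :: rest }) .inp rest)
        (mk { F with inp := rest, fl := flagR true ++ F.fl }) 0 := (Runs.skip _).of_eq (by simp [flagR]) le_rfl
    exact Runs.mono (Runs.pop_cons rfl h) (by norm_num)

/-- Phase 1 on a field followed by flag, ticks and answers. [folklore] -/
theorem runs_p1 (w : List Γ') (g : Bool) (i : ℕ) (bs : List Bool) : ∀ F : Regs,
    Runs p1 (mk { F with inp := w.map some ++ none :: bt g :: (List.replicate i (bt true) ++ none :: bs.map bt) })
      (mk { F with
              inp := [], a := (w.map some).reverse ++ F.a, fl := flagR g ++ F.fl, tk := List.replicate i mark ++ F.tk,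
              ob := List.replicate (bs.count true) mark ++ F.ob })
      (3 * w.length + 3 * i + 3 * bs.length + 12) := by
  induction w with
  | nil =>
    intro F
    have ht := runs_pTicks i bs { F with fl := flagR g ++ F.fl }
    simp only at ht
    have hbody : Runs (p1Body none)
        (Function.update (mk { F with inp := none :: bt g :: (List.replicate i (bt true) ++ none :: bs.map bt) }) .inp
          (bt g :: (List.replicate i (bt true) ++ none :: bs.map bt)))
        (mk { F with
                inp := [], fl := flagR g ++ F.fl, tk := List.replicate i mark ++ F.tk,
                ob := List.replicate (bs.count true) mark ++ F.ob }) (3 + (3 * i + 3 * bs.length + 4)) := by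
      change Runs (readFlag ;; pTicks) _ _ _
      simp only [update_mk, setR_inp]
      exact (runs_readFlag g (List.replicate i (bt true) ++ none :: bs.map bt) F).seq ht
    have hend : Runs p1
        (mk { F with
                inp := [], fl := flagR g ++ F.fl, tk := List.replicate i mark ++ F.tk,
                ob := List.replicate (bs.count true) mark ++ F.ob })
        (mk { F with
                inp := [], fl := flagR g ++ F.fl, tk := List.replicate i mark ++ F.tk,
                ob := List.replicate (bs.count true) mark ++ F.ob }) 1 := Runs.loop_nil _ (by simp)
    exact (Runs.loop_cons (f := p1Body) (by simp) hbody hend).of_eq (by simp) (by omega)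
  | cons γ w ih =>
    intro F
    have h1 : Runs (p1Body (some γ))
        (Function.update (mk { F with inp := (γ :: w).map some ++ none :: bt g ::
          (List.replicate i (bt true) ++ none :: bs.map bt) }) .inp
          (w.map some ++ none :: bt g :: (List.replicate i (bt true) ++ none :: bs.map bt)))
        (mk { F with
                inp := w.map some ++ none :: bt g :: (List.replicate i (bt true) ++ none :: bs.map bt),
                a := some γ :: F.a }) 1 := Runs.push' (by simp)
    have h2 := ih { F with a := some γ :: F.a }
    simp only at h2
    exact (Runs.loop_cons (f := p1Body) (by simp) h1 h2).of_eq (by simp) (by simp; omega)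

/-! ### Phase 3: one step of the main loop -/

/-- A Boolean word pushed in order onto a register: reversed output bits. [folklore] -/
def rv (w : List Bool) : List Sym := (w.map bt).reverse

/-- `rv` of a concatenation. [folklore] -/
@[simp] theorem rv_append (u w : List Bool) : rv (u ++ w) = rv w ++ rv u := by simp [rv]

/-- `rv` of nil. [folklore] -/
@[simp] theorem rv_nil : rv [] = [] := rfl

/-- `rv` of a singleton. [folklore] -/
@[simp] theorem rv_singleton (b : Bool) : rv [b] = [bt b] := rfl

/-- `rv` of a cons. [folklore] -/
theorem rv_cons (b : Bool) (w : List Bool) : rv (b :: w) = rv w ++ [bt b] := by simp [rv]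

/-- Length of `rv`. [folklore] -/
@[simp] theorem length_rv (w : List Bool) : (rv w).length = w.length := by simp [rv]

/-- `rv` of a constant word. [folklore] -/
theorem rv_replicate (n : ℕ) (b : Bool) : rv (List.replicate n b) = List.replicate n (bt b) := by
  simp [rv, List.map_replicate]

/-- `rv` reversed is the word of bits. [folklore] -/
theorem reverse_rv (w : List Bool) : (rv w).reverse = bitsO w := by simp [rv, bitsO, bt]

/-- `pour` on a record. [folklore] -/
theorem runs_pour_mk {x y : KP} (hab : x ≠ y) (F : Regs) :
    Runs (pour x y) (mk F) (mk (setR (setR F x []) y ((mk F x).reverse ++ mk F y))) (3 * (mk F x).length + 1) := by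
  have h := runs_pour hab (mk F)
  rw [update_mk, update_mk] at h
  convert h using 3

/-- `clear` on a record. [folklore] -/
theorem runs_clear_mk (k : KP) (F : Regs) : Runs (clear k) (mk F) (mk (setR F k [])) (2 * (mk F k).length + 1) := by
  simpa using runs_clear k (mk F)

/-- One iteration of the main loop: pop the mode, then the dispatched action. [folklore] -/
theorem runs_body3 {s M : Sym} {F : Regs} {R' : Store} {B : ℕ}
    (h : Runs (dispatch (some M) s) (mk { F with st := [] }) R' B) : Runs (body3 s) (mk { F with st := [M] }) R' (B + 2) :=
  Runs.pop_cons' rfl (by simp) h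

/-- Mode `SKP`, a symbol other than `blank`: nothing happens. [folklore] -/
theorem step_skp {γ : Γ'} (hγ : γ ≠ Γ'.blank) (F : Regs) :
    Runs (body3 (some γ)) (mk { F with st := [SKP] }) (mk { F with st := [SKP] }) 3 := by
  refine runs_body3 ?_
  cases γ with
  | blank => exact absurd rfl hγ
  | bit b => exact Runs.push' (by simp)
  | bra => exact Runs.push' (by simp)
  | ket => exact Runs.push' (by simp)
  | comma => exact Runs.push' (by simp)

/-- Mode `SKP` at a formula boundary with a tick left: the tick is consumed, skipping continues.
[folklore] -/
theorem step_skp_blank_cons (F : Regs) (T : List Sym) :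
    Runs (body3 (some Γ'.blank)) (mk { F with st := [SKP], tk := mark :: T }) (mk { F with st := [SKP], tk := T }) 5 := by
  refine runs_body3 (F := { F with tk := mark :: T }) ?_
  change Runs boundary _ _ _
  exact Runs.pop_cons rfl (Runs.push' (by simp))

/-- Mode `SKP` at a formula boundary with no tick left: the next formula is selected (mode `HD`,
tag bit `0`). [folklore] -/
theorem step_skp_blank_nil (F : Regs) :
    Runs (body3 (some Γ'.blank)) (mk { F with st := [SKP], tk := [] })
      (mk { F with st := [HD], tk := [], outr := bt false :: F.outr }) 6 := by
  refine runs_body3 (F := { F with tk := [] }) ?_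
  change Runs boundary _ _ _
  exact Runs.pop_nil rfl ((Runs.push _ _ _).seq (Runs.push' (by simp)))

/-- Mode `HD`, a header digit: nothing happens. [folklore] -/
theorem step_hd_bit (d : Bool) (F : Regs) :
    Runs (body3 (some (Γ'.bit d))) (mk { F with st := [HD] }) (mk { F with st := [HD] }) 3 :=
  runs_body3 (Runs.push' (by simp))

/-- Mode `HD`, the comma: the clauses begin. [folklore] -/
theorem step_hd_comma (F : Regs) :
    Runs (body3 (some Γ'.comma)) (mk { F with st := [HD] }) (mk { F with st := [CL] }) 3 :=
  runs_body3 (Runs.push' (by simp))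

/-- Mode `CL`, a `bra`: a clause begins (`11` on the clause count). [folklore] -/
theorem step_cl_bra (F : Regs) :
    Runs (body3 (some Γ'.bra)) (mk { F with st := [CL] }) (mk { F with st := [LT], outr := rv [true, true] ++ F.outr }) 5 := by
  refine runs_body3 ?_
  change Runs (pushBits .outr [true, true] ;; push .st LT) _ _ _
  exact ((runs_pushBits _ _ _).seq (Runs.push' (by simp [rv]))).of_eq rfl (by simp)

/-- Mode `CL`, the `blank`: the formula ends (`01`, then the clause blocks, onto the code).
[folklore] -/
theorem step_cl_blank (F : Regs) :
    Runs (body3 (some Γ'.blank)) (mk { F with st := [CL], t1 := [] })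
      (mk { F with st := [DONE], outr := F.cb ++ (rv [false, true] ++ F.outr), cb := [], t1 := [] }) (6 * F.cb.length + 7) := by
  have h := (runs_pushBits KP.outr [false, true] { F with st := [], t1 := [] }).seq
    ((runs_pour_mk (x := .cb) (y := .t1) (by decide) _).seq
      ((runs_pour_mk (x := .t1) (y := .outr) (by decide) _).seq (Runs.push KP.st DONE _)))
  simp only [setR_outr, setR_cb, setR_t1, mk_cb, mk_t1, mk_outr, update_mk, setR_st, mk_st,
    List.reverse_reverse, List.length_reverse, List.append_nil, List.length_cons, List.length_nil] at h
  have hin : Runs (dispatch (some CL) (some Γ'.blank)) (mk { F with st := [], t1 := [] })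
      (mk { F with st := [DONE], outr := F.cb ++ (rv [false, true] ++ F.outr), cb := [], t1 := [] }) (6 * F.cb.length + 5) := by
    change Runs (pushBits .outr [false, true] ;; pour .cb .t1 ;; pour .t1 .outr ;; push .st DONE) _ _ _
    refine h.of_eq ?_ ?_
    · simp [rv]
    · omega
  exact Runs.of_eq (runs_body3 (F := { F with t1 := [] }) hin) rfl (by omega)

/-- Mode `LT`, a polarity bit: a literal begins (`1111` on the literal count). [folklore] -/
theorem step_lt_bit (b : Bool) (F : Regs) :
    Runs (body3 (some (Γ'.bit b))) (mk { F with st := [LT] })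
      (mk { F with st := [DG b], cb := rv [true, true, true, true] ++ F.cb }) 7 := by
  refine runs_body3 ?_
  change Runs (pushBits .cb [true, true, true, true] ;; push .st (DG b)) _ _ _
  exact ((runs_pushBits _ _ _).seq (Runs.push' (by simp [rv]))).of_eq rfl (by simp)

/-- Mode `LT`, the `ket`: the clause ends (`0011`, the literal blocks, `01` onto the clause blocks).
[folklore] -/
theorem step_lt_ket (F : Regs) :
    Runs (body3 (some Γ'.ket)) (mk { F with st := [LT], t1 := [] })
      (mk { F with st := [CL], cb := rv [false, true] ++ (F.lb ++ (rv [false, false, true, true] ++ F.cb)), lb := [], t1 := [] })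
      (6 * F.lb.length + 11) := by
  have h := (runs_pushBits KP.cb [false, false, true, true] { F with st := [], t1 := [] }).seq
    ((runs_pour_mk (x := .lb) (y := .t1) (by decide) _).seq ((runs_pour_mk (x := .t1) (y := .cb) (by decide) _).seq
      ((runs_pushBits KP.cb [false, true] _).seq (Runs.push KP.st CL _))))
  simp only [setR_cb, setR_lb, setR_t1, mk_cb, mk_t1, mk_lb, update_mk, setR_st, mk_st,
    List.reverse_reverse, List.length_reverse, List.append_nil, List.length_cons, List.length_nil] at h
  have hin : Runs (dispatch (some LT) (some Γ'.ket)) (mk { F with st := [], t1 := [] })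
      (mk { F with st := [CL], cb := rv [false, true] ++ (F.lb ++ (rv [false, false, true, true] ++ F.cb)), lb := [], t1 := [] })
      (6 * F.lb.length + 9) := by
    change Runs (pushBits .cb [false, false, true, true] ;; pour .lb .t1 ;; pour .t1 .cb ;; pushBits .cb [false, true] ;;
      push .st CL) _ _ _
    refine h.of_eq ?_ ?_
    · simp [rv]
    · omega
  exact Runs.of_eq (runs_body3 (F := { F with t1 := [] }) hin) rfl (by omega)

/-- Mode `DG b`, a digit `d`: `d⁸` onto the literal blocks. [folklore] -/
theorem step_dg_bit (b d : Bool) (F : Regs) :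
    Runs (body3 (some (Γ'.bit d))) (mk { F with st := [DG b] })
      (mk { F with st := [DG b], lb := rv [d, d, d, d, d, d, d, d] ++ F.lb }) 11 := by
  refine runs_body3 ?_
  change Runs (pushBits .lb [d, d, d, d, d, d, d, d] ;; push .st (DG b)) _ _ _
  exact ((runs_pushBits _ _ _).seq (Runs.push' (by simp [rv]))).of_eq rfl (by simp)

/-- The tail of a literal block: `0⁴ 1⁴ b⁴ 0011`. [folklore] -/
def ltail (b : Bool) : List Bool := [false, false, false, false, true, true, true, true, b, b, b, b, false, false, true, true]

/-- Mode `DG b`, the comma: the literal ends (`0⁴ 1⁴ b⁴ 0011` onto the literal blocks). [folklore] -/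
theorem step_dg_comma (b : Bool) (F : Regs) :
    Runs (body3 (some Γ'.comma)) (mk { F with st := [DG b] }) (mk { F with st := [LT], lb := rv (ltail b) ++ F.lb }) 19 := by
  refine runs_body3 ?_
  change Runs (pushBits .lb (ltail b) ;; push .st LT) _ _ _
  exact ((runs_pushBits _ _ _).seq (Runs.push' (by simp [rv]))).of_eq rfl (by simp [ltail])

/-- Mode `DONE`: nothing happens. [folklore] -/
theorem step_done (s : Sym) (F : Regs) :
    Runs (body3 s) (mk { F with st := [DONE] }) (mk { F with st := [DONE] }) 3 :=
  runs_body3 (Runs.push' (by simp))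

/-! ### Phase 3: segments of the main loop -/

/-- Mode `SKP` over a word without `blank`: nothing happens. [folklore] -/
theorem seg_skp : ∀ (w : List Γ') (_ : Γ'.blank ∉ w) (rest : List Sym) (F : Regs),
    SegRuns .b body3 (w.map some) (mk { F with b := w.map some ++ rest, st := [SKP] })
      (mk { F with b := rest, st := [SKP] }) (5 * w.length)
  | [], _, rest, F => by simpa using SegRuns.nil KP.b body3 (mk { F with b := rest, st := [SKP] })
  | γ :: w, hw, rest, F => by
    have hγ : γ ≠ Γ'.blank := fun h => hw (h ▸ List.mem_cons_self)
    have ih := seg_skp w (fun h => hw (List.mem_cons_of_mem _ h)) rest F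
    have h1 := step_skp hγ { F with b := w.map some ++ rest }
    simp only at h1
    refine SegRuns.mono ?_ (show 3 + 2 + 5 * w.length ≤ 5 * (γ :: w).length by simp; omega)
    exact SegRuns.cons' (w := _ ++ rest) rfl (by simp only [update_mk, setR_b]) h1 ih

/-- Mode `DONE` over any word: nothing happens. [folklore] -/
theorem seg_done : ∀ (u rest : List Sym) (F : Regs),
    SegRuns .b body3 u (mk { F with b := u ++ rest, st := [DONE] }) (mk { F with b := rest, st := [DONE] }) (5 * u.length)
  | [], rest, F => by simpa using SegRuns.nil KP.b body3 (mk { F with b := rest, st := [DONE] })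
  | s :: u, rest, F => by
    have ih := seg_done u rest F
    have h1 := step_done s { F with b := u ++ rest }
    simp only at h1
    refine SegRuns.mono ?_ (show 3 + 2 + 5 * u.length ≤ 5 * (s :: u).length by simp; omega)
    exact SegRuns.cons' (w := _ ++ rest) rfl (by simp only [update_mk, setR_b]) h1 ih

/-- Mode `HD` over header digits: nothing happens. [folklore] -/
theorem seg_hd : ∀ (ds : List Bool) (rest : List Sym) (F : Regs),
    SegRuns .b body3 ((ds.map Γ'.bit).map some) (mk { F with b := (ds.map Γ'.bit).map some ++ rest, st := [HD] })
      (mk { F with b := rest, st := [HD] }) (5 * ds.length)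
  | [], rest, F => by simpa using SegRuns.nil KP.b body3 (mk { F with b := rest, st := [HD] })
  | d :: ds, rest, F => by
    have ih := seg_hd ds rest F
    have h1 := step_hd_bit d { F with b := (ds.map Γ'.bit).map some ++ rest }
    simp only at h1
    refine SegRuns.mono ?_ (show 3 + 2 + 5 * ds.length ≤ 5 * (d :: ds).length by simp; omega)
    exact SegRuns.cons' (w := _ ++ rest) rfl (by simp only [update_mk, setR_b]) h1 ih

/-- Mode `DG b` over digits: each digit eightfold onto the literal blocks. [folklore] -/
theorem seg_dg (b : Bool) : ∀ (ds : List Bool) (rest : List Sym) (F : Regs),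
    SegRuns .b body3 ((ds.map Γ'.bit).map some) (mk { F with b := (ds.map Γ'.bit).map some ++ rest, st := [DG b] })
      (mk { F with b := rest, st := [DG b], lb := rv (repBits 8 ds) ++ F.lb }) (13 * ds.length)
  | [], rest, F => by simpa using SegRuns.nil KP.b body3 (mk { F with b := rest, st := [DG b] })
  | d :: ds, rest, F => by
    have h1 := step_dg_bit b d { F with b := (ds.map Γ'.bit).map some ++ rest }
    have ih := seg_dg b ds rest { F with lb := rv [d, d, d, d, d, d, d, d] ++ F.lb }
    simp only at h1 ih
    refine SegRuns.of_eq ?_ (R₁ := mk { F with b := rest, st := [DG b], lb := rv (repBits 8 ds) ++ (rv [d, d, d, d, d, d, d, d] ++ F.lb) })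
      (by simp [repBits_cons, List.replicate, rv]) (show 11 + 2 + 13 * ds.length ≤ 13 * (d :: ds).length by simp; omega)
    exact SegRuns.cons' (w := _ ++ rest) rfl (by simp only [update_mk, setR_b]) h1 ih

/-- A literal block is the eightfold numeral and the tail. [folklore] -/
theorem lblock_eq (l : Literal ℕ) : lblock l = repBits 8 (encodeNat l.1) ++ ltail l.2 := rfl

/-- Mode `LT` over a literal: `1111` onto the clause blocks, the literal block onto the literal
blocks. [folklore] -/
theorem seg_lit (l : Literal ℕ) (rest : List Sym) (F : Regs) :
    SegRuns .b body3 ((KCNF.encodeLiteral l).map some)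
      (mk { F with b := (KCNF.encodeLiteral l).map some ++ rest, st := [LT] })
      (mk { F with b := rest, st := [LT], cb := rv [true, true, true, true] ++ F.cb, lb := rv (lblock l) ++ F.lb })
      (13 * (KCNF.encodeLiteral l).length + 4) := by
  rcases l with ⟨v, b⟩
  have e : (KCNF.encodeLiteral (v, b)).map some =
      some (Γ'.bit b) :: (((encodeNat v).map Γ'.bit).map some ++ [some Γ'.comma]) := by simp [KCNF.encodeLiteral]
  rw [e, List.cons_append, List.append_assoc]
  have h1 := step_lt_bit b { F with b := ((encodeNat v).map Γ'.bit).map some ++ ([some Γ'.comma] ++ rest) }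
  have h2 := seg_dg b (encodeNat v) ([some Γ'.comma] ++ rest) { F with st := [DG b], cb := rv [true, true, true, true] ++ F.cb }
  have h3 := step_dg_comma b { F with b := rest, cb := rv [true, true, true, true] ++ F.cb, lb := rv (repBits 8 (encodeNat v)) ++ F.lb }
  simp only at h1 h2 h3
  have h23 := h2.append (SegRuns.single (w := rest) rfl (by simpa using h3))
  have hh := SegRuns.cons' (k := KP.b) (f := body3) (a := some (Γ'.bit b))
    (R := mk { F with b := some (Γ'.bit b) :: (((encodeNat v).map Γ'.bit).map some ++ ([some Γ'.comma] ++ rest)), st := [LT] })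
    (w := _ ++ ([some Γ'.comma] ++ rest)) rfl (by simp only [update_mk, setR_b]) h1 h23
  refine hh.of_eq ?_ ?_
  · simp only [lblock_eq, rv_append, List.append_assoc]
  · simp [KCNF.encodeLiteral]; omega

/-- The cost of the literals of a clause. [folklore] -/
def costLits (c : Clause ℕ) : ℕ := 13 * (c.flatMap KCNF.encodeLiteral).length + 4 * c.length

/-- Mode `LT` over the literals of a clause. [folklore] -/
theorem seg_lits : ∀ (c : Clause ℕ) (rest : List Sym) (F : Regs),
    SegRuns .b body3 ((c.flatMap KCNF.encodeLiteral).map some)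
      (mk { F with b := (c.flatMap KCNF.encodeLiteral).map some ++ rest, st := [LT] })
      (mk { F with
              b := rest, st := [LT], cb := rv (List.replicate (4 * c.length) true) ++ F.cb,
              lb := rv (c.flatMap lblock) ++ F.lb }) (costLits c)
  | [], rest, F => by simpa [costLits] using SegRuns.nil KP.b body3 (mk { F with b := rest, st := [LT] })
  | l :: c, rest, F => by
    have h1 := seg_lit l ((c.flatMap KCNF.encodeLiteral).map some ++ rest) F
    have h2 := seg_lits c rest { F with cb := rv [true, true, true, true] ++ F.cb, lb := rv (lblock l) ++ F.lb }
    simp only at h1 h2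
    rw [List.flatMap_cons, List.map_append, List.append_assoc]
    have ecb : rv (List.replicate (4 * c.length) true) ++ (rv [true, true, true, true] ++ F.cb) =
        rv (List.replicate (4 * (l :: c).length) true) ++ F.cb := by
      rw [← List.append_assoc, ← rv_append, List.length_cons, show 4 * (c.length + 1) = 4 + 4 * c.length by ring,
        List.replicate_add]; rfl
    have elb : rv (c.flatMap lblock) ++ (rv (lblock l) ++ F.lb) = rv ((l :: c).flatMap lblock) ++ F.lb := by
      rw [← List.append_assoc, ← rv_append, List.flatMap_cons]
    rw [ecb, elb] at h2
    refine (h1.append h2).of_eq rfl ?_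
    simp [costLits]; ring_nf; omega

/-- The cost of a clause. [folklore] -/
def costClause (c : Clause ℕ) : ℕ := costLits c + 6 * (c.flatMap lblock).length + 20

/-- Mode `CL` over a clause: `11` onto the code, the clause block onto the clause blocks. [folklore] -/
theorem seg_clause (c : Clause ℕ) (rest : List Sym) (F : Regs) :
    SegRuns .b body3 ((KCNF.encodeClause c).map some)
      (mk { F with b := (KCNF.encodeClause c).map some ++ rest, st := [CL], lb := [], t1 := [] })
      (mk { F with b := rest, st := [CL], outr := rv [true, true] ++ F.outr, cb := rv (cblock c) ++ F.cb, lb := [], t1 := [] })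
      (costClause c) := by
  have e : (KCNF.encodeClause c).map some =
      some Γ'.bra :: ((c.flatMap KCNF.encodeLiteral).map some ++ [some Γ'.ket]) := by simp [KCNF.encodeClause]
  rw [e, List.cons_append, List.append_assoc]
  have h1 := step_cl_bra { F with b := (c.flatMap KCNF.encodeLiteral).map some ++ ([some Γ'.ket] ++ rest), lb := [], t1 := [] }
  have h2 := seg_lits c ([some Γ'.ket] ++ rest) { F with st := [LT], outr := rv [true, true] ++ F.outr, lb := [], t1 := [] }
  have h3 := step_lt_ket { F with
    b := rest, outr := rv [true, true] ++ F.outr,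
    cb := rv (List.replicate (4 * c.length) true) ++ F.cb, lb := rv (c.flatMap lblock) }
  simp only [List.append_nil] at h1 h2 h3
  have h23 := h2.append (SegRuns.single (w := rest) rfl (by simpa using h3))
  have hh := SegRuns.cons' (k := KP.b) (f := body3) (a := some Γ'.bra)
    (R := mk { F with b := some Γ'.bra :: ((c.flatMap KCNF.encodeLiteral).map some ++ ([some Γ'.ket] ++ rest)), st := [CL], lb := [], t1 := [] })
    (w := _ ++ ([some Γ'.ket] ++ rest)) rfl (by simp only [update_mk, setR_b]) h1 h23
  refine hh.of_eq ?_ ?_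
  · simp only [cblock, rv_append, List.append_assoc]
  · simp [costClause, costLits]; omega

/-- The cost of a list of clauses. [folklore] -/
def costClauses (cs : CNF ℕ) : ℕ := (cs.map costClause).sum

/-- Mode `CL` over clauses. [folklore] -/
theorem seg_clauses : ∀ (cs : CNF ℕ) (rest : List Sym) (F : Regs),
    SegRuns .b body3 ((cs.flatMap KCNF.encodeClause).map some)
      (mk { F with b := (cs.flatMap KCNF.encodeClause).map some ++ rest, st := [CL], lb := [], t1 := [] })
      (mk { F with
              b := rest, st := [CL], outr := rv (List.replicate (2 * cs.length) true) ++ F.outr,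
              cb := rv (cs.flatMap cblock) ++ F.cb, lb := [], t1 := [] }) (costClauses cs)
  | [], rest, F => by simpa [costClauses] using SegRuns.nil KP.b body3 (mk { F with b := rest, st := [CL], lb := [], t1 := [] })
  | c :: cs, rest, F => by
    have h1 := seg_clause c ((cs.flatMap KCNF.encodeClause).map some ++ rest) F
    have h2 := seg_clauses cs rest { F with outr := rv [true, true] ++ F.outr, cb := rv (cblock c) ++ F.cb }
    simp only at h1 h2
    rw [List.flatMap_cons, List.map_append, List.append_assoc]
    have eo : rv (List.replicate (2 * cs.length) true) ++ (rv [true, true] ++ F.outr) =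
        rv (List.replicate (2 * (c :: cs).length) true) ++ F.outr := by
      rw [← List.append_assoc, ← rv_append, List.length_cons, show 2 * (cs.length + 1) = 2 + 2 * cs.length by ring,
        List.replicate_add]; rfl
    have ecb : rv (cs.flatMap cblock) ++ (rv (cblock c) ++ F.cb) = rv ((c :: cs).flatMap cblock) ++ F.cb := by
      rw [← List.append_assoc, ← rv_append, List.flatMap_cons]
    rw [eo, ecb] at h2
    refine (h1.append h2).of_eq rfl ?_
    simp [costClauses]

/-- The cost of a formula. [folklore] -/
def costFormula (n : ℕ) (cs : CNF ℕ) : ℕ := 5 * (encodeNat n).length + 5 + costClauses cs + (6 * (cs.flatMap cblock).length + 9)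

/-- **Mode `HD` over a formula and its `blank`**: the tree's Boolean CNF code of its clauses is
pushed (in order) onto the code register, and the mode becomes `DONE`. [folklore] -/
theorem seg_formula (n : ℕ) (cs : CNF ℕ) (rest : List Sym) (F : Regs) :
    SegRuns .b body3 ((kword n cs ++ [Γ'.blank]).map some)
      (mk { F with b := (kword n cs ++ [Γ'.blank]).map some ++ rest, st := [HD], cb := [], lb := [], t1 := [] })
      (mk { F with b := rest, st := [DONE], outr := rv (encodingCNF.encode cs) ++ F.outr, cb := [], lb := [], t1 := [] })
      (costFormula n cs) := by
  have e : (kword n cs ++ [Γ'.blank]).map some = ((encodeNat n).map Γ'.bit).map some ++ (some Γ'.comma ::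
      ((cs.flatMap KCNF.encodeClause).map some ++ [some Γ'.blank])) := by simp [kword]
  rw [e]
  have h1 := seg_hd (encodeNat n) (some Γ'.comma :: ((cs.flatMap KCNF.encodeClause).map some ++ ([some Γ'.blank] ++ rest)))
    { F with cb := [], lb := [], t1 := [] }
  have h2 := step_hd_comma { F with b := (cs.flatMap KCNF.encodeClause).map some ++ ([some Γ'.blank] ++ rest), cb := [], lb := [], t1 := [] }
  have h3 := seg_clauses cs ([some Γ'.blank] ++ rest) { F with cb := [], lb := [], t1 := [] }
  have h4 := step_cl_blank { F with
    b := rest, outr := rv (List.replicate (2 * cs.length) true) ++ F.outr,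
    cb := rv (cs.flatMap cblock), lb := [] }
  simp only [List.append_nil] at h1 h2 h3 h4
  have h34 := h3.append (SegRuns.single (w := rest) rfl (by simpa using h4))
  have h234 := SegRuns.cons' (k := KP.b) (f := body3) (a := some Γ'.comma)
    (R := mk { F with b := some Γ'.comma :: ((cs.flatMap KCNF.encodeClause).map some ++ ([some Γ'.blank] ++ rest)), st := [HD], cb := [], lb := [], t1 := [] })
    (w := (cs.flatMap KCNF.encodeClause).map some ++ ([some Γ'.blank] ++ rest)) rfl (by simp only [update_mk, setR_b]) h2 h34
  have h := h1.append h234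
  simp only [List.append_assoc, List.cons_append, List.nil_append] at h ⊢
  refine h.of_eq ?_ ?_
  · simp only [encodingCNF_encode_eq, rv_append, List.append_assoc]
  · simp [costFormula]; omega

/-! ### Sizes of the emitted blocks and the cost of a formula -/

/-- A literal block is eight times the `Γ'`-literal. [folklore] -/
theorem length_lblock (l : Literal ℕ) : (lblock l).length = 8 * (KCNF.encodeLiteral l).length := by
  simp [lblock, KCNF.encodeLiteral]; ring

/-- The literal blocks of a clause are eight times its `Γ'`-literals. [folklore] -/
theorem length_flatMap_lblock (c : Clause ℕ) :
    (c.flatMap lblock).length = 8 * (c.flatMap KCNF.encodeLiteral).length := by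
  induction c with
  | nil => simp
  | cons l c ih => simp only [List.flatMap_cons, List.length_append, ih, length_lblock]; ring

/-- A clause has at most half as many literals as `Γ'`-symbols in its literals. [folklore] -/
theorem two_mul_length_le (c : Clause ℕ) : 2 * c.length ≤ (c.flatMap KCNF.encodeLiteral).length := by
  induction c with
  | nil => simp
  | cons l c ih =>
    simp only [List.flatMap_cons, List.length_append, List.length_cons]
    have : 2 ≤ (KCNF.encodeLiteral l).length := by simp [KCNF.encodeLiteral]
    omega

/-- A clause block is at most ten times the `Γ'`-clause. [folklore] -/
theorem length_cblock_le (c : Clause ℕ) : (cblock c).length ≤ 10 * (KCNF.encodeClause c).length := by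
  simp only [cblock, List.length_append, List.length_replicate, List.length_cons, List.length_nil,
    length_flatMap_lblock, KCNF.encodeClause, List.cons_append]
  have := two_mul_length_le c
  omega

/-- The cost of a clause and the transfer of its block: at most `125` per `Γ'`-symbol. [folklore] -/
theorem costClause_le (c : Clause ℕ) : costClause c + 6 * (cblock c).length ≤ 125 * (KCNF.encodeClause c).length := by
  have h1 := length_cblock_le c
  have h2 := two_mul_length_le c
  have h3 := length_flatMap_lblock c
  have h4 : (KCNF.encodeClause c).length = (c.flatMap KCNF.encodeLiteral).length + 2 := by simp [KCNF.encodeClause]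
  unfold costClause costLits
  rw [h4] at h1 ⊢
  omega

/-- The cost of the clauses and the transfer of their blocks. [folklore] -/
theorem costClauses_le (cs : CNF ℕ) :
    costClauses cs + 6 * (cs.flatMap cblock).length ≤ 125 * (cs.flatMap KCNF.encodeClause).length := by
  induction cs with
  | nil => simp [costClauses]
  | cons c cs ih =>
    have := costClause_le c
    simp only [costClauses, List.map_cons, List.sum_cons, List.flatMap_cons, List.length_append] at ih ⊢
    omega

/-- **The cost of a formula is linear**: at most `125 |KCNF.encode| + 14`. [folklore] -/
theorem costFormula_le (n : ℕ) (cs : CNF ℕ) : costFormula n cs ≤ 125 * (kword n cs).length + 14 := by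
  have := costClauses_le cs
  simp only [costFormula, kword, List.length_append, List.length_map, List.length_cons]
  omega

/-! ### Phase 3: formulas, skipping and selecting -/

/-- The field word of a list of formulas (`KCNF.encodeList`, lifted). [folklore] -/
def fw {k : ℕ} (Fs : List (KCNF k)) : List Sym := (KCNF.encodeList Fs).map some

/-- The field word of no formulas. [folklore] -/
@[simp] theorem fw_nil {k : ℕ} : fw ([] : List (KCNF k)) = [] := rfl

/-- The field word of one more formula. [folklore] -/
theorem fw_cons {k : ℕ} (ψ : KCNF k) (Fs : List (KCNF k)) :
    fw (ψ :: Fs) = (kword ψ.numVars ψ.clauses ++ [Γ'.blank]).map some ++ fw Fs := by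
  simp [fw, KCNF.encodeList, encode_eq_kword]

/-- Length of the field word of one more formula. [folklore] -/
theorem length_fw_cons {k : ℕ} (ψ : KCNF k) (Fs : List (KCNF k)) :
    (fw (ψ :: Fs)).length = (kword ψ.numVars ψ.clauses).length + 1 + (fw Fs).length := by
  simp [fw_cons]; omega

/-- No `blank` occurs inside the code of a formula. [folklore] -/
theorem blank_not_mem_kword (n : ℕ) (cs : CNF ℕ) : Γ'.blank ∉ kword n cs := by
  simp [kword, KCNF.encodeClause, KCNF.encodeLiteral]

/-- Mode `HD` at the selected formula: it is transliterated, the following formulas are passed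
over. [folklore] -/
theorem seg_sel {k : ℕ} (ψ : KCNF k) (post : List (KCNF k)) (rest : List Sym) (F : Regs) :
    SegRuns .b body3 (fw (ψ :: post))
      (mk { F with b := fw (ψ :: post) ++ rest, st := [HD], cb := [], lb := [], t1 := [] })
      (mk { F with b := rest, st := [DONE], outr := rv (encodingCNF.encode ψ.clauses) ++ F.outr, cb := [], lb := [], t1 := [] })
      (130 * (fw (ψ :: post)).length) := by
  have h1 := seg_formula ψ.numVars ψ.clauses (fw post ++ rest) F
  have h2 := seg_done (fw post) rest { F with outr := rv (encodingCNF.encode ψ.clauses) ++ F.outr, cb := [], lb := [], t1 := [] }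
  simp only at h1 h2
  rw [fw_cons, List.append_assoc]
  refine (h1.append h2).mono ?_
  have := costFormula_le ψ.numVars ψ.clauses
  simp; omega

/-- The outcome of the selection phase on the remaining formulas: the mode, the ticks left, the
code register. [folklore] -/
def sel {k : ℕ} : List (KCNF k) → Sym × List Sym × List Sym
  | [] => (HD, [], [bt false])
  | χ :: _ => (DONE, [], rv (encodingCNF.encode χ.clauses) ++ [bt false])

/-- The outcome of the skipping phase with `t` ticks left on the remaining formulas. [folklore] -/
def res {k : ℕ} : List (KCNF k) → ℕ → Sym × List Sym × List Sym
  | [], t => (SKP, List.replicate t mark, [])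
  | _ :: Fs, 0 => sel Fs
  | _ :: Fs, t + 1 => res Fs t

/-- **The skipping phase**: mode `SKP` with `t` ticks left over the remaining formulas. [folklore] -/
theorem seg_res {k : ℕ} : ∀ (Fs : List (KCNF k)) (t : ℕ) (rest : List Sym) (F : Regs),
    SegRuns .b body3 (fw Fs)
      (mk { F with b := fw Fs ++ rest, st := [SKP], tk := List.replicate t mark, outr := [], cb := [], lb := [], t1 := [] })
      (mk { F with
              b := rest, st := [(res Fs t).1], tk := (res Fs t).2.1, outr := (res Fs t).2.2, cb := [], lb := [], t1 := [] })
      (130 * (fw Fs).length)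
  | [], t, rest, F => by
    simpa [res] using SegRuns.nil KP.b body3 (mk { F with
      b := rest, st := [SKP], tk := List.replicate t mark, outr := [], cb := [], lb := [], t1 := [] })
  | ψ :: Fs, t, rest, F => by
    have h1 := seg_skp (kword ψ.numVars ψ.clauses) (blank_not_mem_kword _ _) (some Γ'.blank :: (fw Fs ++ rest))
      { F with tk := List.replicate t mark, outr := [], cb := [], lb := [], t1 := [] }
    rw [fw_cons]
    simp only [List.map_append, List.map_cons, List.map_nil, List.append_assoc, List.cons_append,
      List.nil_append] at h1 ⊢
    refine (h1.append (?seg : SegRuns KP.b body3 _ _ _ (130 * (fw Fs).length + 130))).mono ?cost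
    case cost => simp only [List.length_append, List.length_map, List.length_cons]; omega
    cases t with
    | succ t =>
      have h2 := step_skp_blank_cons { F with b := fw Fs ++ rest, outr := [], cb := [], lb := [], t1 := [] } (List.replicate t mark)
      have h3 := seg_res Fs t rest F
      simp only at h2 h3
      refine SegRuns.mono ?_ (show 5 + 2 + 130 * (fw Fs).length ≤ _ by omega)
      exact SegRuns.cons' (k := KP.b) (f := body3) (a := some Γ'.blank) (w := fw Fs ++ rest)
        (R := mk { F with
          b := some Γ'.blank :: (fw Fs ++ rest), st := [SKP], tk := List.replicate (t + 1) mark, outr := [], cb := [],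
          lb := [], t1 := [] }) rfl (by simp only [update_mk, setR_b, List.replicate_succ]) h2 (by simpa [res] using h3)
    | zero =>
      have h2 := step_skp_blank_nil { F with b := fw Fs ++ rest, outr := [], cb := [], lb := [], t1 := [] }
      simp only at h2
      cases Fs with
      | nil =>
        refine SegRuns.mono ?_ (show 6 + 2 + 0 ≤ _ by omega)
        exact SegRuns.cons' (k := KP.b) (f := body3) (a := some Γ'.blank) (w := rest) (u := [])
          (R := mk { F with
            b := some Γ'.blank :: (fw ([] : List (KCNF k)) ++ rest), st := [SKP], tk := List.replicate 0 mark, outr := [],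
            cb := [], lb := [], t1 := [] }) rfl (by simp only [update_mk, setR_b, fw_nil, List.nil_append, List.replicate_zero])
          h2 (by simpa [res, sel] using SegRuns.nil KP.b body3 (mk { F with
            b := rest, st := [HD], tk := [], outr := [bt false], cb := [], lb := [], t1 := [] }))
      | cons χ post =>
        have h3 := seg_sel χ post rest { F with tk := [], outr := [bt false] }
        simp only at h3
        refine SegRuns.mono ?_ (show 6 + 2 + 130 * (fw (χ :: post)).length ≤ _ by omega)
        exact SegRuns.cons' (k := KP.b) (f := body3) (a := some Γ'.blank) (w := fw (χ :: post) ++ rest)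
          (R := mk { F with
            b := some Γ'.blank :: (fw (χ :: post) ++ rest), st := [SKP], tk := List.replicate 0 mark, outr := [], cb := [],
            lb := [], t1 := [] }) rfl (by simp only [update_mk, setR_b, List.replicate_zero]) h2 (by simpa [res, sel] using h3)

/-- Phase 3 from mode `SKP`. [folklore] -/
theorem runs_p3_res {k : ℕ} (Fs : List (KCNF k)) (t : ℕ) (F : Regs) :
    Runs p3 (mk { F with b := fw Fs, st := [SKP], tk := List.replicate t mark, outr := [], cb := [], lb := [], t1 := [] })
      (mk { F with b := [], st := [(res Fs t).1], tk := (res Fs t).2.1, outr := (res Fs t).2.2, cb := [], lb := [], t1 := [] })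
      (130 * (fw Fs).length + 1) := by
  have h := seg_res Fs t [] F
  simp only [List.append_nil] at h
  exact h.runs_loop_nil (by simp)

/-- Phase 3 from mode `HD` (the first formula is selected). [folklore] -/
theorem runs_p3_sel {k : ℕ} (Fs : List (KCNF k)) (F : Regs) :
    Runs p3 (mk { F with b := fw Fs, st := [HD], tk := [], outr := [bt false], cb := [], lb := [], t1 := [] })
      (mk { F with b := [], st := [(sel Fs).1], tk := (sel Fs).2.1, outr := (sel Fs).2.2, cb := [], lb := [], t1 := [] })
      (130 * (fw Fs).length + 1) := by
  cases Fs with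
  | nil => exact (Runs.loop_nil body3 (by simp)).of_eq (by simp [sel]) (by simp)
  | cons χ post =>
    have h := seg_sel χ post [] { F with tk := [], outr := [bt false] }
    simp only [List.append_nil] at h
    exact (h.runs_loop_nil (by simp)).of_eq (by simp [sel]) le_rfl

/-- The outcome of the boundary decision and phase 3 with `i` ticks. [folklore] -/
def out {k : ℕ} (Fs : List (KCNF k)) : ℕ → Sym × List Sym × List Sym
  | 0 => sel Fs
  | j + 1 => res Fs j

/-- **Boundary and phase 3**: the outcome `out Fs i`. [folklore] -/
theorem runs_boundary_p3 {k : ℕ} (Fs : List (KCNF k)) (i : ℕ) (F : Regs) :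
    Runs (boundary ;; p3) (mk { F with b := fw Fs, st := [], tk := List.replicate i mark, outr := [], cb := [], lb := [], t1 := [] })
      (mk { F with b := [], st := [(out Fs i).1], tk := (out Fs i).2.1, outr := (out Fs i).2.2, cb := [], lb := [], t1 := [] })
      (130 * (fw Fs).length + 5) := by
  cases i with
  | zero =>
    have hb : Runs boundary (mk { F with b := fw Fs, st := [], tk := List.replicate 0 mark, outr := [], cb := [], lb := [], t1 := [] })
        (mk { F with b := fw Fs, st := [HD], tk := [], outr := [bt false], cb := [], lb := [], t1 := [] }) 4 :=
      Runs.pop_nil rfl ((Runs.push _ _ _).seq (Runs.push' (by simp)))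
    exact (hb.seq (runs_p3_sel Fs F)).of_eq rfl (by omega)
  | succ j =>
    have hb : Runs boundary (mk { F with b := fw Fs, st := [], tk := List.replicate (j + 1) mark, outr := [], cb := [], lb := [], t1 := [] })
        (mk { F with b := fw Fs, st := [SKP], tk := List.replicate j mark, outr := [], cb := [], lb := [], t1 := [] }) 3 :=
      Runs.pop_cons rfl (Runs.push' (by simp))
    exact (hb.seq (runs_p3_res Fs j F)).of_eq rfl (by omega)

/-- **The outcome, explicitly.** With `r` formulas and `i` ticks: if `i < r`, formula `i` has been
transliterated (mode `DONE`, code register = its Boolean CNF code after the tag bit, no tick left);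
otherwise the mode is not `DONE`, `i - r - 1` ticks are left and the code register holds at most the
tag bit. [folklore] -/
theorem out_spec {k : ℕ} : ∀ (Fs : List (KCNF k)) (i : ℕ),
    (∀ h : i < Fs.length, out Fs i = (DONE, [], rv (encodingCNF.encode (Fs[i]).clauses) ++ [bt false])) ∧
    (Fs.length ≤ i → (∃ γ, (out Fs i).1 = some γ) ∧ (out Fs i).2.1 = List.replicate (i - Fs.length - 1) mark ∧
      ((out Fs i).2.2 = [] ∨ (out Fs i).2.2 = [bt false])) := by
  -- through `res`, by induction on the formulas
  have hres : ∀ (Fs : List (KCNF k)) (t : ℕ),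
      (∀ h : t + 1 < Fs.length, res Fs t = (DONE, [], rv (encodingCNF.encode (Fs[t + 1]).clauses) ++ [bt false])) ∧
      (Fs.length ≤ t + 1 → (∃ γ, (res Fs t).1 = some γ) ∧ (res Fs t).2.1 = List.replicate (t - Fs.length) mark ∧
        ((res Fs t).2.2 = [] ∨ (res Fs t).2.2 = [bt false])) := by
    intro Fs
    induction Fs with
    | nil => intro t; exact ⟨fun h => by simp at h, fun _ => ⟨⟨_, rfl⟩, by simp [res], Or.inl rfl⟩⟩
    | cons ψ Fs ih =>
      intro t
      cases t with
      | zero =>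
        cases Fs with
        | nil => exact ⟨fun h => by simp at h, fun _ => ⟨⟨_, rfl⟩, rfl, Or.inr rfl⟩⟩
        | cons χ post => exact ⟨fun _ => rfl, fun h => by simp at h⟩
      | succ t =>
        obtain ⟨h1, h2⟩ := ih t
        refine ⟨fun h => ?_, fun h => ?_⟩
        · simpa [res] using h1 (by simpa using h)
        · simpa [res] using h2 (by simpa using h)
  intro Fs i
  cases i with
  | zero =>
    cases Fs with
    | nil => exact ⟨fun h => by simp at h, fun _ => ⟨⟨_, rfl⟩, rfl, Or.inr rfl⟩⟩
    | cons χ post => exact ⟨fun _ => rfl, fun h => by simp at h⟩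
  | succ j =>
    obtain ⟨h1, h2⟩ := hres Fs j
    refine ⟨fun h => h1 h, fun h => ?_⟩
    obtain ⟨a, b, c⟩ := h2 h
    exact ⟨a, by rw [out, b]; congr 1; omega, c⟩

/-! ### Phase 4 -/

/-- Phase 4 with the flag down: everything is discarded, the answer is `false`. [folklore] -/
theorem runs_p4_bad (M : Sym) (T O X : List Sym) (F : Regs) :
    Runs p4 (mk { F with fl := [mark], st := [M], tk := T, ob := O, outr := X, cb := [], lb := [] })
      (mk { F with fl := [], st := [], tk := [], ob := [], outr := [], cb := [], lb := [], out := bt true :: bt false :: F.out })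
      (2 * T.length + 2 * O.length + 2 * X.length + 12) := by
  unfold p4
  have h := (runs_clear_mk .st { F with fl := [], st := [M], tk := T, ob := O, outr := X, cb := [], lb := [] }).seq
    ((runs_clear_mk .tk _).seq ((runs_clear_mk .ob _).seq ((runs_clear_mk .outr _).seq ((runs_clear_mk .cb _).seq
      ((runs_clear_mk .lb _).seq ((Runs.push KP.out (bt false) _).seq (Runs.push KP.out (bt true) _)))))))
  simp only [setR_st, setR_tk, setR_ob, setR_outr, setR_cb, setR_lb, mk_st, mk_tk, mk_ob, mk_outr, mk_cb, mk_lb, mk_out,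
    List.length_cons, List.length_nil] at h
  exact Runs.mono (Runs.pop_cons rfl (by simpa using h)) (by omega)

/-- Phase 4 after a transliteration: the query (tag bit and code) is poured onto the output.
[folklore] -/
theorem runs_p4_query (T O X : List Sym) (F : Regs) :
    Runs p4 (mk { F with fl := [], st := [DONE], tk := T, ob := O, outr := X, out := [] })
      (mk { F with fl := [], st := [], tk := [], ob := [], outr := [], out := X.reverse })
      (3 * X.length + 2 * T.length + 2 * O.length + 7) := by
  unfold p4
  have h := (runs_pour_mk (x := .outr) (y := .out) (by decide) { F with fl := [], st := [], tk := T, ob := O, outr := X, out := [] }).seq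
    ((runs_clear_mk .tk _).seq (runs_clear_mk .ob _))
  simp only [setR_tk, setR_ob, setR_outr, mk_tk, mk_ob, mk_outr, mk_out, setR_out, List.append_nil] at h
  refine Runs.mono (B := (3 * X.length + 1 + (2 * T.length + 1 + (2 * O.length + 1))) + 2 + 2) ?_ (by omega)
  exact Runs.pop_nil rfl (Runs.pop_cons rfl (by simpa [DONE] using h))

/-- Phase 4 without a transliteration: the answer bit "some oracle answer was `true`". [folklore] -/
theorem runs_p4_answer (γ : Γ') (T O X : List Sym) (F : Regs) (hX : X.length ≤ 1) :
    Runs p4 (mk { F with fl := [], st := [some γ], tk := T, ob := O, outr := X, out := [] })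
      (mk { F with fl := [], st := [], tk := [], ob := [], outr := [], out := [bt true, bt (decide (O ≠ []))] })
      (2 * T.length + 2 * O.length + 12) := by
  unfold p4
  have hA := runs_clear_mk .tk { F with fl := [], st := [], tk := T, ob := O, outr := X, out := [] }
  have hB := runs_clear_mk .outr { F with fl := [], st := [], tk := [], ob := O, outr := X, out := [] }
  simp only [setR_tk, setR_outr, mk_tk, mk_outr] at hA hB
  have h3 : Runs (pop KP.ob fun o => match o with
        | some _ => clear .ob ;; push .out (bt true) ;; push .out (bt true)
        | none => push .out (bt false) ;; push .out (bt true) : Prog)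
      (mk { F with fl := [], st := [], tk := [], ob := O, outr := [], out := [] })
      (mk { F with fl := [], st := [], tk := [], ob := [], outr := [], out := [bt true, bt (decide (O ≠ []))] })
      (2 * O.length + 4) := by
    cases O with
    | nil => exact Runs.mono (Runs.pop_nil rfl ((Runs.push _ _ _).seq (Runs.push' (by simp)))) (by simp)
    | cons o O =>
      have h := (runs_clear_mk .ob { F with fl := [], st := [], tk := [], ob := O, outr := [], out := [] }).seq
        ((Runs.push KP.out (bt true) _).seq (Runs.push KP.out (bt true) _))
      simp only [setR_ob, mk_ob, mk_out, update_mk, setR_out] at h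
      exact Runs.mono (Runs.pop_cons rfl (by simpa using h)) (by simp)
  have h := hA.seq (hB.seq h3)
  refine Runs.mono (B := (2 * T.length + 1 + (2 * X.length + 1 + (2 * O.length + 4))) + 2 + 2) ?_ (by omega)
  exact Runs.pop_nil rfl (Runs.pop_cons rfl (by cases γ <;> simpa using h))

/-! ### The whole back end -/

/-- The output of the back end, as bits: the answer `false` if the flag is down; the query (tag `0`
and the Boolean CNF code of formula `i`) if `i < r`; the answer "some oracle answer was `true`"
otherwise. [folklore] -/
def postOut {k : ℕ} (Fs : List (KCNF k)) (g : Bool) (i : ℕ) (bs : List Bool) : List Bool :=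
  if g then (if h : i < Fs.length then false :: encodingCNF.encode (Fs[i]).clauses else [true, decide (true ∈ bs)])
  else [true, false]

/-- The clause blocks are at most ten times the `Γ'`-clauses. [folklore] -/
theorem length_flatMap_cblock_le (cs : CNF ℕ) : (cs.flatMap cblock).length ≤ 10 * (cs.flatMap KCNF.encodeClause).length := by
  induction cs with
  | nil => simp
  | cons c cs ih =>
    have := length_cblock_le c
    simp only [List.flatMap_cons, List.length_append]; omega

/-- There are at most half as many clauses as `Γ'`-symbols in them. [folklore] -/
theorem two_mul_length_le_clauses (cs : CNF ℕ) : 2 * cs.length ≤ (cs.flatMap KCNF.encodeClause).length := by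
  induction cs with
  | nil => simp
  | cons c cs ih =>
    have : 2 ≤ (KCNF.encodeClause c).length := by simp [KCNF.encodeClause]
    simp only [List.flatMap_cons, List.length_append, List.length_cons]; omega

/-- The Boolean CNF code of a formula is at most twelve times its `Γ'`-code. [folklore] -/
theorem length_encode_clauses_le (n : ℕ) (cs : CNF ℕ) : (encodingCNF.encode cs).length ≤ 12 * (kword n cs).length := by
  rw [encodingCNF_encode_eq]
  have h1 := length_flatMap_cblock_le cs
  have h2 := two_mul_length_le_clauses cs
  simp only [kword, List.length_append, List.length_replicate, List.length_cons, List.length_nil, List.length_map]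
  omega

/-- A formula of the list is shorter than the field. [folklore] -/
theorem length_kword_le_fw {k : ℕ} {ψ : KCNF k} {Fs : List (KCNF k)} (h : ψ ∈ Fs) :
    (kword ψ.numVars ψ.clauses).length + 1 ≤ (fw Fs).length := by
  induction Fs with
  | nil => simp at h
  | cons χ Fs ih =>
    rw [length_fw_cons]
    rcases List.mem_cons.1 h with rfl | h
    · omega
    · have := ih h; omega

/-- The ticks left are at most the ticks given. [folklore] -/
theorem length_out_tk_le {k : ℕ} (Fs : List (KCNF k)) (i : ℕ) : ((out Fs i).2.1).length ≤ i := by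
  obtain ⟨h1, h2⟩ := out_spec Fs i
  by_cases h : i < Fs.length
  · rw [h1 h]; simp
  · obtain ⟨-, hb, -⟩ := h2 (not_lt.1 h)
    rw [hb, List.length_replicate]; omega

/-- The empty record. [folklore] -/
def e0 : Regs := ⟨[], [], [], [], [], [], [], [], [], [], [], []⟩

/-- **Effect and cost of the back end.** On the word `postIn Fs g i bs` in the input register (all
other registers empty) the program ends with `postOut Fs g i bs` (as bits) in the output register,
all other registers empty, within `200 · |postIn| + 60` steps. [folklore] -/
theorem runs_prog {k : ℕ} (Fs : List (KCNF k)) (g : Bool) (i : ℕ) (bs : List Bool) :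
    Runs prog (AStore.single .inp (postIn Fs g i bs)) (AStore.single .out (bitsO (postOut Fs g i bs)))
      (200 * (postIn Fs g i bs).length + 60) := by
  rw [single_inp, single_out]
  have hL : (postIn Fs g i bs).length = (fw Fs).length + i + bs.length + 3 := by
    simp [postIn, fw]; omega
  have hfw : (KCNF.encodeList Fs).length = (fw Fs).length := by simp [fw]
  -- phase 1, pour, boundary and phase 3
  have h1 := runs_p1 (KCNF.encodeList Fs) g i bs e0
  have h2 := runs_pour_mk (x := .a) (y := .b) (by decide)
    { e0 with a := (fw Fs).reverse, fl := flagR g, tk := List.replicate i mark, ob := List.replicate (bs.count true) mark }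
  have h3 := runs_boundary_p3 Fs i { e0 with fl := flagR g, ob := List.replicate (bs.count true) mark }
  simp only [e0, setR_a, setR_b, mk_a, mk_b, List.reverse_reverse, List.append_nil, List.length_reverse] at h1 h2 h3
  rw [show (List.map some (KCNF.encodeList Fs)) = fw Fs from rfl, hfw] at h1
  have h123 := h1.seq (h2.seq h3)
  -- phase 4, by cases
  obtain ⟨hlt, hge⟩ := out_spec Fs i
  have htk := length_out_tk_le Fs i
  cases g with
  | false =>
    have h4 := runs_p4_bad (out Fs i).1 (out Fs i).2.1 (List.replicate (bs.count true) mark) (out Fs i).2.2 e0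
    simp only [e0] at h4
    have hX : ((out Fs i).2.2).length ≤ 12 * (fw Fs).length + 3 := by
      by_cases h : i < Fs.length
      · rw [hlt h]
        have e1 := length_encode_clauses_le (Fs[i]).numVars (Fs[i]).clauses
        have e2 := length_kword_le_fw (List.getElem_mem h)
        simp; omega
      · obtain ⟨-, -, hc | hc⟩ := hge (not_lt.1 h)
        · rw [hc]; simp
        · rw [hc]; simp
    refine (h123.seq (by simpa [flagR] using h4)).of_eq (by simp [postOut, bitsO, bt]) ?_
    simp only [List.length_replicate] at *
    have := List.count_le_length (a := true) (l := bs)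
    omega
  | true =>
    by_cases h : i < Fs.length
    · have h4 := runs_p4_query [] (List.replicate (bs.count true) mark) (rv (encodingCNF.encode (Fs[i]).clauses) ++ [bt false]) e0
      simp only [e0] at h4
      have e1 := length_encode_clauses_le (Fs[i]).numVars (Fs[i]).clauses
      have e2 := length_kword_le_fw (List.getElem_mem h)
      rw [hlt h] at h123
      refine (h123.seq (by simpa [flagR] using h4)).of_eq ?_ ?_
      · simp [postOut, h, reverse_rv, bitsO, bt]
      · simp only [List.length_replicate, List.length_append, length_rv, List.length_singleton, List.length_nil] at *
        have := List.count_le_length (a := true) (l := bs)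
        omega
    · obtain ⟨⟨γ, hγ⟩, htk', hX⟩ := hge (not_lt.1 h)
      have hXl : ((out Fs i).2.2).length ≤ 1 := by rcases hX with hc | hc <;> simp [hc]
      have h4 := runs_p4_answer γ (out Fs i).2.1 (List.replicate (bs.count true) mark) (out Fs i).2.2 e0 hXl
      simp only [e0] at h4
      rw [← hγ] at h4
      refine (h123.seq (by simpa [flagR] using h4)).of_eq ?_ ?_
      · have : (!decide (List.count true bs = 0)) = decide (true ∈ bs) := by
          by_cases hm : true ∈ bs
          · simp [hm, List.count_eq_zero.not.2 (not_not.2 hm)]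
          · simp [hm, List.count_eq_zero.2 hm]
        simp [postOut, h, bitsO, bt, this]
      · simp only [List.length_replicate] at *
        have := List.count_le_length (a := true) (l := bs)
        omega

/-- Length of the input word of the back end. [folklore] -/
theorem length_postIn {k : ℕ} (Fs : List (KCNF k)) (g : Bool) (i : ℕ) (bs : List Bool) :
    (postIn Fs g i bs).length = (KCNF.encodeList Fs).length + i + bs.length + 3 := by
  simp [postIn]; omega

/-- **The output of the back end is short**: at most `12 |KCNF.encodeList Fs| + 3` bits. [folklore] -/
theorem length_postOut_le {k : ℕ} (Fs : List (KCNF k)) (g : Bool) (i : ℕ) (bs : List Bool) :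
    (postOut Fs g i bs).length ≤ 12 * (KCNF.encodeList Fs).length + 3 := by
  unfold postOut
  split_ifs with hg hi
  · have e1 := length_encode_clauses_le (Fs[i]).numVars (Fs[i]).clauses
    have e2 := length_kword_le_fw (List.getElem_mem hi)
    have e3 : (fw Fs).length = (KCNF.encodeList Fs).length := by simp [fw]
    simp only [List.length_cons]; omega
  · simp
  · simp

/-- **The back end as a machine**: `postIn ↦ postOut` (as bits over `Option Γ'`) within
`200 · |postIn| + 61` steps on Mathlib's `TM2` model. [folklore] -/
theorem computesInTime (k : ℕ) :
    ∃ M : Turing.TM2ComputableAux Sym Sym,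
      Complexity.ComputesInTime (fun a : List (KCNF k) × Bool × ℕ × List Bool => postIn a.1 a.2.1 a.2.2.1 a.2.2.2)
        bitsO (fun a => postOut a.1 a.2.1 a.2.2.1 a.2.2.2)
        (fun a => 200 * (postIn a.1 a.2.1 a.2.2.1 a.2.2.2).length + 60 + 1) M :=
  ACom.exists_computesInTime prog .inp .out _ _ _ _ fun a => runs_prog a.1 a.2.1 a.2.2.1 a.2.2.2

end Post

end Literature.Computability.FineGrained.SerfKSat
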